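import Literature.NumberTheory.LFunctions.LagariasCriterion
import Literature.NumberTheory.LFunctions.ExtraordinaryNumbersProofs
import HarnessLib

/-!
# RH-FREE — Lagarias's unconditional bound `σ(n) < H_n + 2 exp(H_n) log(H_n)` (`n > 1`) (Broughan vol. 1, §7.11 "Unconditional Lagarias"): PROVED for `n ≤ 10^1958000` outright, and for all `n` from Robin's Thm. 2 / Dusart's `θ` bound; nothing here bears on the truth of RH

RH-FREE (an unconditional inequality; nothing is asserted about RH). Literature-typing tranche
`rh-lit-broughan-1` (Broughan, *Equivalents of the Riemann Hypothesis* vol. 1, CUP 2017, Ch. 7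
"Euler's totient function", §7.11 "Unconditional Lagarias" — the section that accompanies
Lagarias's criterion `RH ⟺ σ(n) ≤ H_n + exp(H_n) log(H_n)` (§7.10, the tree's
`Literature.NumberTheory.LFunctions.lagarias_iff_holds`) with its unconditional companion).
The printed statement (Lagarias, Problem 10949, Amer. Math. Monthly 109 (2002) 569; quoted by
Caveney–Nicolas–Sondow 2011, p. 2: "Lagarias also proved, unconditionally, that
`σ(n) < H_n + 2 exp(H_n) log(H_n)` (`n > 1`)"):

  for every `n > 1`, `σ(n) < H_n + 2 exp(H_n) log(H_n)`.

The proof is the obvious one from Robin's unconditional theorem (Robin 1984, Thm. 2: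
`σ(n)/n ≤ e^γ log log n + 0.6482…/log log n` for `n ≥ 3`, the tree's named fact `Robin1984_thm2`,
which the tree PROVES for `3 ≤ n ≤ 10^1958000` (`CNSCheck.robinBoundAt_of_le_ten_pow`) and derives
in full from Dusart's bound `|θ(x) − x| < 0.2 x/log² x` (`x ≥ 3594641`)
(`Robin1984_thm2_of_dusart`)) together with Lagarias's Lemma 3.1
(`e^γ n log log n ≤ exp(H_n) log(H_n)`, the tree's `Lagarias2002_lemma_3_1`): for `n > 5040`,
`0.649/log log n < e^γ log log n`, so `σ(n) < 2 e^γ n log log n ≤ 2 exp(H_n) log(H_n)`; for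
`2 ≤ n ≤ 5040` the sharper `σ(n) ≤ H_n + exp(H_n) log(H_n)` is the tree's kernel check
`sigma_le_harmonic_add_exp_mul_log_of_le_5040` (Lagarias's own computer verification), and
`exp(H_n) log(H_n) > 0` because `H_n > 1`.

Contents: `LagariasTwoBoundAt n` (the inequality at one `n`), `lagariasTwoBoundAt_of_le_5040`,
`lagariasTwoBoundAt_of_robinBoundAt`, **`lagariasTwoBoundAt_of_le_ten_pow`** (unconditional for
`2 ≤ n ≤ 10^1958000`, standard axioms), **`Lagarias2002_problem10949_of_robin_thm2`**
(`Robin1984_thm2 →` the bound for every `n ≥ 2`) and **`Lagarias2002_problem10949_of_dusart`**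
(`Dusart2010_theta_thm_5_2 →` the same). No new named fact is introduced.

## References

* J. C. Lagarias, Problem 10949, Amer. Math. Monthly 109 (2002), 569. [Lagarias2002Problem10949]
* J. C. Lagarias, *An elementary problem equivalent to the Riemann hypothesis*, Amer. Math. Monthly
  109 (2002), 534–543, Lemma 3.1. [Lagarias2002] (held: arXiv:math/0008177)
* G. Caveney, J.-L. Nicolas, J. Sondow, *Robin's theorem, primes, and a new elementary
  reformulation of the Riemann Hypothesis*, Integers 11 (2011) A33, p. 2 (the display after Thm. 4).
  [CaveneyNicolasSondow2011] (held: [corpus:paper:arxiv-1110.5078 p0002])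
* G. Robin, *Grandes valeurs de la fonction somme des diviseurs et hypothèse de Riemann*, J. Math.
  Pures Appl. 63 (1984), 187–213, Thm. 2. [Robin1984]
* P. Dusart, *Estimates of some functions over primes without R.H.*, arXiv:1002.0442 (2010),
  Thm. 5.2. [Dusart2010]
* K. Broughan, *Equivalents of the Riemann Hypothesis. Vol. 1*, CUP 2017, §7.11 "Unconditional
  Lagarias". [Broughan2017Arithmetic] (not held, acq-00318)
-/

noncomputable section

open Real
open scoped ArithmeticFunction.sigma

namespace Literature.NumberTheory.LFunctions

/-- Lagarias's unconditional inequality at one integer `n`: `σ(n) < H_n + 2 exp(H_n) log(H_n)`.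
[cite: Lagarias2002Problem10949, statement; CaveneyNicolasSondow2011, p. 2 (display after Thm. 4); Broughan2017Arithmetic, §7.11] -/
def LagariasTwoBoundAt (n : ℕ) : Prop :=
  (σ 1 n : ℝ) < (harmonic n : ℝ) + 2 * exp (harmonic n : ℝ) * log (harmonic n : ℝ)

/-- `H_n > 1` for `n ≥ 2` (`H_n > log n + γ ≥ log 2 + γ > 0.69 + 0.5`). [folklore] -/
private theorem one_lt_harmonic {n : ℕ} (hn : 2 ≤ n) : (1 : ℝ) < (harmonic n : ℝ) := by
  have hH := log_add_eulerMascheroniConstant_lt_harmonic (n := n) (by omega)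
  have h2 : log 2 ≤ log n := log_le_log two_pos (by exact_mod_cast hn)
  have hl2 := log_two_gt_d9
  have hγ := one_half_lt_eulerMascheroniConstant
  linarith

/-- **The case `2 ≤ n ≤ 5040`** (from Lagarias's own computer check of the sharper
`σ(n) ≤ H_n + exp(H_n) log(H_n)`, the tree's `sigma_le_harmonic_add_exp_mul_log_of_le_5040`, and
`exp(H_n) log(H_n) > 0`). [cite: Lagarias2002, §3, proof of Thm. 1.1 (computer check n ≤ 5040); Lagarias2002Problem10949, statement] -/
theorem lagariasTwoBoundAt_of_le_5040 {n : ℕ} (h2 : 2 ≤ n) (h5040 : n ≤ 5040) :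
    LagariasTwoBoundAt n := by
  have h := sigma_le_harmonic_add_exp_mul_log_of_le_5040 n (by omega) h5040
  have hH := one_lt_harmonic h2
  have hpos : 0 < exp (harmonic n : ℝ) * log (harmonic n : ℝ) :=
    mul_pos (exp_pos _) (log_pos hH)
  unfold LagariasTwoBoundAt
  linarith

/-- **The case `n > 5040` from Robin's bound at `n`**: if `σ(n)/n ≤ e^γ log log n + C/log log n`
(`C = 0.6482…`), then `σ(n) < H_n + 2 exp(H_n) log(H_n)`. Indeed `log n > 2`, so `log log n > log 2`
and `C/log log n < 0.649/0.693 < e^{1/2} · 0.693 < e^γ log log n`, whence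
`σ(n) < 2 e^γ n log log n ≤ 2 exp(H_n) log(H_n)` by Lagarias's Lemma 3.1.
[cite: Lagarias2002Problem10949, statement; Robin1984, Thm. 2; Lagarias2002, Lemma 3.1] -/
theorem lagariasTwoBoundAt_of_robinBoundAt {n : ℕ} (hn : 5040 < n) (h : CNSCheck.RobinBoundAt n) :
    LagariasTwoBoundAt n := by
  have hn0 : (0 : ℝ) < n := by exact_mod_cast (show 0 < n by omega)
  have hn8 : (8 : ℝ) ≤ n := by exact_mod_cast (show 8 ≤ n by omega)
  -- `log n > 2`
  have hlogn : 2 < log n := by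
    rw [lt_log_iff_exp_lt hn0]
    have h1 := exp_one_lt_d9
    have h0 : 0 < exp 1 := exp_pos 1
    calc exp 2 = exp 1 * exp 1 := by rw [← exp_add]; norm_num
      _ < 2.7182818286 * 2.7182818286 := mul_lt_mul'' h1 h1 h0.le h0.le
      _ < 8 := by norm_num
      _ ≤ n := hn8
  have hlogpos : 0 < log n := by linarith
  -- `log log n > log 2 > 0.693`
  have hLL : log 2 < log (log n) := log_lt_log two_pos hlogn
  have hl2 := log_two_gt_d9
  have hLLpos : 0 < log (log n) := by linarith
  set L : ℝ := log (log n) with hL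
  set C : ℝ := (7 / 3 - rexp eulerMascheroniConstant * Real.log (Real.log 12)) *
    Real.log (Real.log 12) with hC
  obtain ⟨hC0, hC1⟩ := CNSCheck.robinC_bounds
  -- `e^γ > e^{1/2} > 1.64`
  have hγ : exp (1 / 2) < rexp eulerMascheroniConstant := exp_lt_exp.2 one_half_lt_eulerMascheroniConstant
  have hehalf : (1.64 : ℝ) < exp (1 / 2) := by
    have h := Real.add_one_le_exp (1 / 2 : ℝ)
    -- `exp(1/2)² = e > 2.7182818 > 1.64²`
    have h2 : exp (1 / 2) * exp (1 / 2) = exp 1 := by rw [← exp_add]; norm_num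
    have he := exp_one_gt_d9
    nlinarith [exp_pos (1 / 2 : ℝ)]
  have hG : (1.64 : ℝ) < rexp eulerMascheroniConstant := hehalf.trans hγ
  -- `C / L < e^γ L`
  have hCL : C / L < rexp eulerMascheroniConstant * L := by
    rw [div_lt_iff₀ hLLpos]
    have : (0.649 : ℝ) < 1.64 * (0.6931471803 * 0.6931471803) := by norm_num
    have hLL2 : 0.6931471803 * 0.6931471803 < L * L := by nlinarith
    nlinarith
  -- Robin's bound at `n`, multiplied out
  have hR : (σ 1 n : ℝ) / n ≤ rexp eulerMascheroniConstant * L + C / L := h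
  have hσ : (σ 1 n : ℝ) < 2 * (rexp eulerMascheroniConstant * n * L) := by
    have h1 : (σ 1 n : ℝ) ≤ n * (rexp eulerMascheroniConstant * L + C / L) := by
      rw [div_le_iff₀ hn0] at hR; linarith
    have h2 : n * (rexp eulerMascheroniConstant * L + C / L) <
        n * (2 * (rexp eulerMascheroniConstant * L)) := by
      apply mul_lt_mul_of_pos_left _ hn0
      linarith
    linarith
  have hLag := Lagarias2002_lemma_3_1 (n := n) (by omega)
  have hHpos : 0 < (harmonic n : ℝ) := by linarith [one_lt_harmonic (n := n) (by omega)]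
  unfold LagariasTwoBoundAt
  linarith

/-- **Lagarias's unconditional bound, PROVED for `2 ≤ n ≤ 10^1958000`** (standard axioms): the
tree proves Robin's Thm. 2 in that range (`CNSCheck.robinBoundAt_of_le_ten_pow`).
[cite: Lagarias2002Problem10949, statement; Robin1984, Thm. 2] -/
theorem lagariasTwoBoundAt_of_le_ten_pow {n : ℕ} (h2 : 2 ≤ n) (hn : n ≤ 10 ^ 1958000) :
    LagariasTwoBoundAt n := by
  rcases le_or_gt n 5040 with h | h
  · exact lagariasTwoBoundAt_of_le_5040 h2 h
  · exact lagariasTwoBoundAt_of_robinBoundAt h (CNSCheck.robinBoundAt_of_le_ten_pow (by omega) hn)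

/-- **Lagarias's unconditional bound from Robin's Thm. 2** (the printed derivation): Robin's
`σ(n)/n ≤ e^γ log log n + 0.6482…/log log n` (`n ≥ 3`, the named fact `Robin1984_thm2`) gives
`σ(n) < H_n + 2 exp(H_n) log(H_n)` for every `n ≥ 2`.
[cite: Lagarias2002Problem10949, statement; CaveneyNicolasSondow2011, p. 2; Robin1984, Thm. 2; Broughan2017Arithmetic, §7.11] -/
theorem Lagarias2002_problem10949_of_robin_thm2 (hR : Robin1984_thm2) {n : ℕ} (h2 : 2 ≤ n) :
    LagariasTwoBoundAt n := by
  rcases le_or_gt n 5040 with h | h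
  · exact lagariasTwoBoundAt_of_le_5040 h2 h
  · exact lagariasTwoBoundAt_of_robinBoundAt h (hR n (by omega))

/-- **Lagarias's unconditional bound from Dusart's `θ` bound alone**: `|θ(x) − x| < 0.2 x/log² x`
for `x ≥ 3594641` (`Dusart2010_theta_thm_5_2`, which the tree turns into Robin's Thm. 2,
`Robin1984_thm2_of_dusart`) gives `σ(n) < H_n + 2 exp(H_n) log(H_n)` for every `n ≥ 2`.
[cite: Lagarias2002Problem10949, statement; Dusart2010, Thm. 5.2; Robin1984, Thm. 2] -/
theorem Lagarias2002_problem10949_of_dusart (hD : Dusart2010_theta_thm_5_2) {n : ℕ} (h2 : 2 ≤ n) :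
    LagariasTwoBoundAt n :=
  Lagarias2002_problem10949_of_robin_thm2 (Robin1984_thm2_of_dusart hD) h2

/-- Unfolded form of the unconditional range: for `2 ≤ n ≤ 10^1958000`,
`σ(n) < H_n + 2 exp(H_n) log(H_n)`. [cite: Lagarias2002Problem10949, statement] -/
theorem sigma_lt_harmonic_add_two_mul_exp_mul_log {n : ℕ} (h2 : 2 ≤ n) (hn : n ≤ 10 ^ 1958000) :
    (σ 1 n : ℝ) < (harmonic n : ℝ) + 2 * exp (harmonic n : ℝ) * log (harmonic n : ℝ) :=
  lagariasTwoBoundAt_of_le_ten_pow h2 hn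

end Literature.NumberTheory.LFunctions

end
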